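import Summits.QuantumFields.YangMills.Theorems.ColdStartUniversalityLatticeLangevinGradientBoundFlow
import HarnessLib

/-!
# Route `ColdStartUniversality` (fixed-cut-off package, Bakry–Émery side, GRADIENT half): the integrated gradient bound for `C³` DATA —
# `e^((2−K₀)t) ∫ H·Γ^A(κ_t F) dμ_(β') ≤ ∫ H·κ_t(Γ^A F) dμ_(β')` whenever `𝓛F` has a `C³` compactly supported representative

Helper file (seat `ym-line-csu-p1`, g29; `--supports stmt-QuantumFields-24809`; same proof as `…GradientBoundFlow`).  SZZ dynamics at a fixed cut-off,
ANY realising Markov kernel family `κ`; frame Hessian bound `K₀` of the plaquette function (`hHess`; `K₀ = 24|β'|` by `wilson_hessBound`).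
★★★ `integral_mul_carre_transition_le_of_generatorRep`: the theorem of `…GradientBoundFlow` with the hypothesis `f ∈ C⁵` replaced by
`f ∈ C³_c` TOGETHER WITH a `C³` compactly supported `a` representing `𝓛f` on the group (`a∘coords = 𝓛f`; for `f ∈ C⁵` such an `a` exists
by the frame form of the generator — the only use of `C⁵` there; for `f = κ_s f₀` in the Dynkin class it is supplied by
`transitionKernel_backwardKolmogorov`, which is what the reverse local Poincaré inequality needs): for `C⁵_c` `h` with `H = h∘coords ≥ 0`,
`t ≥ 0` and a `C³_c` representative `g` of `κ_t(f∘coords)`:  `e^((2−K₀)t) · ∫ H·Γ^A(g) dμ_(β') ≤ ∫ H·κ_t(Γ^A f) dμ_(β')`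
(`Γ^A` = coordinate carré du champ = twice that of `𝓛_(β')`) — the INTEGRATED form of Bakry–Émery's `Γ(P_t f) ≤ e^(−2ρt) P_tΓ(f)`,
`ρ = 1 − K₀/2`; the pointwise form follows in the sequel.  PROOF by duality (no time-regularity of spatial derivatives of the semigroup):
`Λ(s) = ∫ κ_s(𝓛H)(κ_(t−s)F)² − 2κ_sH·κ_(t−s)F·κ_(t−s)(𝓛F) dμ` (`= ∫ κ_sH·Γ^A(κ_(t−s)F) dμ`, `flow_value_eq_integral_mul_carre`) is
differentiated with Dynkin's formula only (`transitionKernel_dynkin`); `Λ' ≥ (2−K₀)Λ` is `flow_deriv_ge_of_hessBound` at the Dynkin-class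
representatives (`transitionKernel_backwardKolmogorov`); Grönwall on `[0,t]`; endpoints by `κ_0 = id` and `μ_(β')`-symmetry of `κ_t`
(Ambrosio–Gigli–Savaré's weak form of the Bakry–Émery estimate; BGL Thm 3.3.18).  THEOREMS ONLY, no definition, no sorry.
HONEST FRAMING: fixed cut-off; the rate `2 − K₀` is volume-independent but the route's scaling `β'_K → ∞` leaves the window `K₀ < 2`;
nothing K-uniform; no crux, rung or summit statement is proved; the Yang–Mills mass gap is NOT proved.
-/

set_option autoImplicit false

noncomputable section

namespace Summit.QuantumFields.YangMills.Theorems.ColdStartUniversality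

open MeasureTheory ProbabilityTheory Matrix Complex Finset Filter Set
open scoped ComplexConjugate BigOperators Matrix NNReal ENNReal Topology
open Literature.Probability.Process Literature.MathematicalPhysics.QuantumFieldTheory
open Literature.MathematicalPhysics.QuantumLattice (fundamentalRep fundamentalLatticeRep continuous_fundamentalRep fundamentalRep_apply)

variable {L : ℕ} [NeZero L]


/-- ★★★ **Integrated gradient bound for `C³` data with a `C³` representative of the generator.**  Under the frame Hessian bound `K₀`:
for `C³` compactly supported `f` and `a` with `a∘coords = 𝓛f` on the group, `C⁵` compactly supported `h` with `h∘coords ≥ 0`, any realising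
Markov kernel family `κ`, `t ≥ 0` and any `C³` compactly supported `g` with `κ_t(f∘coords) = g∘coords`,
`e^((2−K₀)t) · ∫ (h∘coords)·Γ^A(g) dμ_(β') ≤ ∫ (h∘coords)(x)·(∫ Γ^A(f) dκ_t x) dμ_(β')(x)`.
[cite: BakryGentilLedoux2014, Thm 3.3.18 and (3.2.4); ShenZhuZhu2022 §4 (4.7)–(4.8)] -/
theorem integral_mul_carre_transition_le_of_generatorRep (L : ℕ) [NeZero L] (β' K₀ : ℝ)
    (hHess : (∀ (V : (GaugeConfig 3 L (Matrix.specialUnitaryGroup (Fin 2) ℂ))) (Λ : (Edge 3 L × Fin (fundamentalLatticeRep 2).N × Fin (fundamentalLatticeRep 2).N × Bool → ℝ) →L[ℝ] ℝ),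
      ∑ n : Edge 3 L × NoiseIdx (fundamentalLatticeRep 2).N, ∑ m : Edge 3 L × NoiseIdx (fundamentalLatticeRep 2).N,
        Λ ((fun q : Edge 3 L × Fin (fundamentalLatticeRep 2).N × Fin (fundamentalLatticeRep 2).N × Bool => if n.1 = q.1 then (fun z : ℂ => if q.2.2.2 then z.im else z.re) (((Real.sqrt 2 : ℂ) • ((fundamentalLatticeRep 2).lieProj (noiseDir n.2) * (fun (ee : Edge 3 L) => Matrix.of fun (i j : Fin (fundamentalLatticeRep 2).N) => (((fun (V : GaugeConfig 3 L (Matrix.specialUnitaryGroup (Fin 2) ℂ)) (q : Edge 3 L × Fin (fundamentalLatticeRep 2).N × Fin (fundamentalLatticeRep 2).N × Bool) => (fun z : ℂ => if q.2.2.2 then z.im else z.re) ((fundamentalRep (Fin 2) (V q.1) : Matrix (Fin 2) (Fin 2) ℂ) q.2.1 q.2.2.1)) V (ee, i, j, false) : ℝ) : ℂ) + (((fun (V : GaugeConfig 3 L (Matrix.specialUnitaryGroup (Fin 2) ℂ)) (q : Edge 3 L × Fin (fundamentalLatticeRep 2).N × Fin (fundamentalLatticeRep 2).N × Bool) => (fun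 z : ℂ => if q.2.2.2 then z.im else z.re) ((fundamentalRep (Fin 2) (V q.1) : Matrix (Fin 2) (Fin 2) ℂ) q.2.1 q.2.2.1)) V (ee, i, j, true) : ℝ) : ℂ) * Complex.I) q.1)) q.2.1 q.2.2.1) else 0)) * Λ ((fun q : Edge 3 L × Fin (fundamentalLatticeRep 2).N × Fin (fundamentalLatticeRep 2).N × Bool => if m.1 = q.1 then (fun z : ℂ => if q.2.2.2 then z.im else z.re) (((Real.sqrt 2 : ℂ) • ((fundamentalLatticeRep 2).lieProj (noiseDir m.2) * (fun (ee : Edge 3 L) => Matrix.of fun (i j : Fin (fundamentalLatticeRep 2).N) => (((fun (V : GaugeConfig 3 L (Matrix.specialUnitaryGroup (Fin 2) ℂ)) (q : Edge 3 L × Fin (fundamentalLatticeRep 2).N × Fin (fundamentalLatticeRep 2).N × Bool) => (fun z : ℂ => if q.2.2.2 then z.im else z.re) ((fundamentalRep (Fin 2) (V q.1) : Matrix (Fin 2) (Fin 2) ℂ) q.2.1 q.2.2.1)) V (ee, i, j, false) : ℝ) : ℂ) + (((fun (V : GaugeConfig 3 L (Matrix.specialUnitaryGroup (Fin 2) ℂ))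 (q : Edge 3 L × Fin (fundamentalLatticeRep 2).N × Fin (fundamentalLatticeRep 2).N × Bool) => (fun z : ℂ => if q.2.2.2 then z.im else z.re) ((fundamentalRep (Fin 2) (V q.1) : Matrix (Fin 2) (Fin 2) ℂ) q.2.1 q.2.2.1)) V (ee, i, j, true) : ℝ) : ℂ) * Complex.I) q.1)) q.2.1 q.2.2.1) else 0)) *
          fderiv ℝ (fun z : (Edge 3 L × Fin (fundamentalLatticeRep 2).N × Fin (fundamentalLatticeRep 2).N × Bool → ℝ) => fderiv ℝ (fun y : (Edge 3 L × Fin (fundamentalLatticeRep 2).N × Fin (fundamentalLatticeRep 2).N × Bool → ℝ) => β' * ∑ p : Plaquette 3 L, (rootedLoop (fun (ee : Edge 3 L) (i j : Fin (fundamentalLatticeRep 2).N) => ((y (ee, i, j, false) : ℝ) : ℂ) + ((y (ee, i, j, true) : ℝ) : ℂ) * Complex.I) (p.1, p.2.1.1) p.2.1.2 false).trace.re) z (fun q : Edge 3 L × Fin (fundamentalLatticeRep 2).N × Fin (fundamentalLatticeRep 2).N × Bool => if m.1 = q.1 then (fun z : ℂ => if q.2.2.2 then z.im else z.re) (((Real.sqrt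 2 : ℂ) • ((fundamentalLatticeRep 2).lieProj (noiseDir m.2) * (fun (ee : Edge 3 L) => Matrix.of fun (i j : Fin (fundamentalLatticeRep 2).N) => ((z (ee, i, j, false) : ℝ) : ℂ) + ((z (ee, i, j, true) : ℝ) : ℂ) * Complex.I) q.1)) q.2.1 q.2.2.1) else 0)) ((fun (V : GaugeConfig 3 L (Matrix.specialUnitaryGroup (Fin 2) ℂ)) (q : Edge 3 L × Fin (fundamentalLatticeRep 2).N × Fin (fundamentalLatticeRep 2).N × Bool) => (fun z : ℂ => if q.2.2.2 then z.im else z.re) ((fundamentalRep (Fin 2) (V q.1) : Matrix (Fin 2) (Fin 2) ℂ) q.2.1 q.2.2.1)) V) (fun q : Edge 3 L × Fin (fundamentalLatticeRep 2).N × Fin (fundamentalLatticeRep 2).N × Bool => if n.1 = q.1 then (fun z : ℂ => if q.2.2.2 then z.im else z.re) (((Real.sqrt 2 : ℂ) • ((fundamentalLatticeRep 2).lieProj (noiseDir n.2) * (fun (ee : Edge 3 L) => Matrix.of fun (i j : Fin (fundamentalLatticeRep 2).N) => (((fun (V : GaugeConfig 3 L (Matrix.specialUnitaryGroup (Fin 2)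 ℂ)) (q : Edge 3 L × Fin (fundamentalLatticeRep 2).N × Fin (fundamentalLatticeRep 2).N × Bool) => (fun z : ℂ => if q.2.2.2 then z.im else z.re) ((fundamentalRep (Fin 2) (V q.1) : Matrix (Fin 2) (Fin 2) ℂ) q.2.1 q.2.2.1)) V (ee, i, j, false) : ℝ) : ℂ) + (((fun (V : GaugeConfig 3 L (Matrix.specialUnitaryGroup (Fin 2) ℂ)) (q : Edge 3 L × Fin (fundamentalLatticeRep 2).N × Fin (fundamentalLatticeRep 2).N × Bool) => (fun z : ℂ => if q.2.2.2 then z.im else z.re) ((fundamentalRep (Fin 2) (V q.1) : Matrix (Fin 2) (Fin 2) ℂ) q.2.1 q.2.2.1)) V (ee, i, j, true) : ℝ) : ℂ) * Complex.I) q.1)) q.2.1 q.2.2.1) else 0)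
        ≤ K₀ * ∑ n : Edge 3 L × NoiseIdx (fundamentalLatticeRep 2).N, (Λ (fun q : Edge 3 L × Fin (fundamentalLatticeRep 2).N × Fin (fundamentalLatticeRep 2).N × Bool => if n.1 = q.1 then (fun z : ℂ => if q.2.2.2 then z.im else z.re) (((Real.sqrt 2 : ℂ) • ((fundamentalLatticeRep 2).lieProj (noiseDir n.2) * (fun (ee : Edge 3 L) => Matrix.of fun (i j : Fin (fundamentalLatticeRep 2).N) => (((fun (V : GaugeConfig 3 L (Matrix.specialUnitaryGroup (Fin 2) ℂ)) (q : Edge 3 L × Fin (fundamentalLatticeRep 2).N × Fin (fundamentalLatticeRep 2).N × Bool) => (fun z : ℂ => if q.2.2.2 then z.im else z.re) ((fundamentalRep (Fin 2) (V q.1) : Matrix (Fin 2) (Fin 2) ℂ) q.2.1 q.2.2.1)) V (ee, i, j, false) : ℝ) : ℂ) + (((fun (V : GaugeConfig 3 L (Matrix.specialUnitaryGroup (Fin 2) ℂ)) (q : Edge 3 L × Fin (fundamentalLatticeRep 2).N × Fin (fundamentalLatticeRep 2).N × Bool) => (fun z : ℂ => if q.2.2.2 then z.im else z.re) ((fundamentalRep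 (Fin 2) (V q.1) : Matrix (Fin 2) (Fin 2) ℂ) q.2.1 q.2.2.1)) V (ee, i, j, true) : ℝ) : ℂ) * Complex.I) q.1)) q.2.1 q.2.2.1) else 0)) ^ 2))
    (κ : ℝ≥0 → Kernel (GaugeConfig 3 L (Matrix.specialUnitaryGroup (Fin 2) ℂ))
      (GaugeConfig 3 L (Matrix.specialUnitaryGroup (Fin 2) ℂ))) [∀ t, IsMarkovKernel (κ t)]
    (hreal : ∀ (t : ℝ≥0) (x : GaugeConfig 3 L (Matrix.specialUnitaryGroup (Fin 2) ℂ))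
        (Ω : Type) [MeasurableSpace Ω] (P : Measure Ω) [IsProbabilityMeasure P]
        (W : ℝ≥0 → Ω → (Edge 3 L × NoiseIdx 2 → ℝ)) (hW : IsFlatBrownian W P)
        (U : ℝ≥0 → Ω → GaugeConfig 3 L (Matrix.specialUnitaryGroup (Fin 2) ℂ)),
        (∀ ω, U 0 ω = x) →
        (latticeLangevinDynamics (fundamentalLatticeRep 2) β').IsSolution (fundamentalRep (Fin 2))
          hW.natFiltration P W U →
        κ t x = P.map (U t))
    {f : (Edge 3 L × Fin 2 × Fin 2 × Bool → ℝ) → ℝ} (hf3 : ContDiff ℝ 3 f) (hfc : HasCompactSupport f)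
    {a : (Edge 3 L × Fin 2 × Fin 2 × Bool → ℝ) → ℝ} (ha : ContDiff ℝ 3 a) (hac : HasCompactSupport a)
    {h : (Edge 3 L × Fin 2 × Fin 2 × Bool → ℝ) → ℝ} (hh : ContDiff ℝ 5 h) (hhc : HasCompactSupport h)
    (t : ℝ≥0) {g : (Edge 3 L × Fin 2 × Fin 2 × Bool → ℝ) → ℝ} (hg : ContDiff ℝ 3 g) (hgc : HasCompactSupport g) :
    let coords : GaugeConfig 3 L (Matrix.specialUnitaryGroup (Fin 2) ℂ) → (Edge 3 L × Fin 2 × Fin 2 × Bool → ℝ) :=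
      fun V q => (fun z : ℂ => if q.2.2.2 then z.im else z.re)
        ((fundamentalRep (Fin 2) (V q.1) : Matrix (Fin 2) (Fin 2) ℂ) q.2.1 q.2.2.1)
    let A : GaugeConfig 3 L (Matrix.specialUnitaryGroup (Fin 2) ℂ) → (Edge 3 L × Fin 2 × Fin 2 × Bool) →
        (Edge 3 L × Fin 2 × Fin 2 × Bool) → ℝ := fun V i j =>
      ∑ n : Edge 3 L × NoiseIdx 2,
        (if n.1 = i.1 then (fun z : ℂ => if i.2.2.2 then z.im else z.re)
          ((latticeLangevinDynamics (fundamentalLatticeRep 2) β').noise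
            (matrixConfig (fundamentalRep (Fin 2)) V) i.1 n.2 i.2.1 i.2.2.1) else 0) *
        (if n.1 = j.1 then (fun z : ℂ => if j.2.2.2 then z.im else z.re)
          ((latticeLangevinDynamics (fundamentalLatticeRep 2) β').noise
            (matrixConfig (fundamentalRep (Fin 2)) V) j.1 n.2 j.2.1 j.2.2.1) else 0)
    let gen : ((Edge 3 L × Fin 2 × Fin 2 × Bool → ℝ) → ℝ) → GaugeConfig 3 L (Matrix.specialUnitaryGroup (Fin 2) ℂ) → ℝ :=
      fun h V =>
      (∑ i : Edge 3 L × Fin 2 × Fin 2 × Bool, fderiv ℝ h (coords V) (Pi.single i 1) *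
          (fun z : ℂ => if i.2.2.2 then z.im else z.re)
            ((latticeLangevinDynamics (fundamentalLatticeRep 2) β').drift
              (matrixConfig (fundamentalRep (Fin 2)) V) i.1 i.2.1 i.2.2.1) +
      1 / 2 * ∑ i : Edge 3 L × Fin 2 × Fin 2 × Bool, ∑ j : Edge 3 L × Fin 2 × Fin 2 × Bool,
        fderiv ℝ (fun z => fderiv ℝ h z (Pi.single i 1)) (coords V) (Pi.single j 1) *
          ∑ n : Edge 3 L × NoiseIdx 2,
            (if n.1 = i.1 then (fun z : ℂ => if i.2.2.2 then z.im else z.re)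
              ((latticeLangevinDynamics (fundamentalLatticeRep 2) β').noise
                (matrixConfig (fundamentalRep (Fin 2)) V) i.1 n.2 i.2.1 i.2.2.1) else 0) *
            (if n.1 = j.1 then (fun z : ℂ => if j.2.2.2 then z.im else z.re)
              ((latticeLangevinDynamics (fundamentalLatticeRep 2) β').noise
                (matrixConfig (fundamentalRep (Fin 2)) V) j.1 n.2 j.2.1 j.2.2.1) else 0))
    (∀ x, a (coords x) = gen f x) → (∀ x, 0 ≤ h (coords x)) → (∀ x, ∫ y, f (coords y) ∂(κ t x) = g (coords x)) →
    Real.exp ((2 - K₀) * (t : ℝ)) * ∫ x, h (coords x) * (∑ i : Edge 3 L × Fin 2 × Fin 2 × Bool, ∑ j : Edge 3 L × Fin 2 × Fin 2 × Bool, fderiv ℝ g (coords x) (Pi.single i 1) * fderiv ℝ g (coords x) (Pi.single j 1) * A x i j) ∂(wilsonMeasure (d := 3) (L := L) (fundamentalRep (Fin 2)) β') ≤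
      ∫ x, h (coords x) * (∫ y, (∑ i : Edge 3 L × Fin 2 × Fin 2 × Bool, ∑ j : Edge 3 L × Fin 2 × Fin 2 × Bool, fderiv ℝ f (coords y) (Pi.single i 1) * fderiv ℝ f (coords y) (Pi.single j 1) * A y i j) ∂(κ t x)) ∂(wilsonMeasure (d := 3) (L := L) (fundamentalRep (Fin 2)) β') := by
  intro coords A gen haf hh0 hgrep
  classical
  haveI := secondCountableTopology_su2
  haveI := borelSpace_config L
  set μ : Measure (GaugeConfig 3 L (Matrix.specialUnitaryGroup (Fin 2) ℂ)) := (wilsonMeasure (d := 3) (L := L) (fundamentalRep (Fin 2)) β') with hμ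
  haveI : IsProbabilityMeasure μ :=
    isProbabilityMeasure_wilsonMeasure (d := 3) (L := L) (fundamentalRep (Fin 2)) (continuous_fundamentalRep (Fin 2)) β'
  have hco : Continuous coords := continuous_coords (L := L)
  have hInt : ∀ {Φ : (GaugeConfig 3 L (Matrix.specialUnitaryGroup (Fin 2) ℂ)) → ℝ}, Continuous Φ → Integrable Φ μ := fun hΦ => integrable_of_continuous_of_compactSpace hΦ μ
  have hκ0 : κ 0 = Kernel.id := transitionKernel_zero_eq_id (L := L) (β' := β') κ hreal
  have hf2 : ContDiff ℝ 2 f := hf3.of_le (by norm_num)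
  obtain ⟨hh3, hh2⟩ : ContDiff ℝ 3 h ∧ ContDiff ℝ 2 h := ⟨hh.of_le (by norm_num), hh.of_le (by norm_num)⟩
  -- §0 `C³` compactly supported ambient representatives `a` of `𝓛f` and `b` of `𝓛h` (frame form of the generator + cut-off)
  obtain ⟨s, c, hs, -, -, -, hCas⟩ := exists_noiseFrame L
  set s2 : (Edge 3 L × NoiseIdx (fundamentalLatticeRep 2).N) → ((Edge 3 L × Fin 2 × Fin 2 × Bool → ℝ) →L[ℝ] (Edge 3 L × Fin 2 × Fin 2 × Bool → ℝ)) := s with hs2def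
  set ψ : (Edge 3 L × Fin 2 × Fin 2 × Bool → ℝ) → ℝ := (fun y : (Edge 3 L × Fin 2 × Fin 2 × Bool → ℝ) => β' * ∑ p : Plaquette 3 L, (rootedLoop (fun (ee : Edge 3 L) (i j : Fin 2) => ((y (ee, i, j, false) : ℝ) : ℂ) + ((y (ee, i, j, true) : ℝ) : ℂ) * Complex.I) (p.1, p.2.1.1) p.2.1.2 false).trace.re) with hψ
  have hψ4 : ContDiff ℝ 4 ψ := contDiff_psiHat (d := 3) (L := L) (N := (fundamentalLatticeRep 2).N) β'
  have hD : ∀ φ : (Edge 3 L × Fin 2 × Fin 2 × Bool → ℝ) → ℝ, ContDiff ℝ 2 φ → ∀ V : (GaugeConfig 3 L (Matrix.specialUnitaryGroup (Fin 2) ℂ)), gen φ V = 1 / 2 * ∑ n : Edge 3 L × NoiseIdx (fundamentalLatticeRep 2).N,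
      (fderiv ℝ (fun w => fderiv ℝ φ w (s2 n w)) (coords V) (s2 n (coords V)) +
        fderiv ℝ ψ (coords V) (s2 n (coords V)) * fderiv ℝ φ (coords V) (s2 n (coords V))) :=
    fun φ hφ V => generator_eq_half_frameGen L β' s hs hCas φ hφ V
  have hrep : ∀ {φ : (Edge 3 L × Fin 2 × Fin 2 × Bool → ℝ) → ℝ}, ContDiff ℝ 5 φ → ∃ a : (Edge 3 L × Fin 2 × Fin 2 × Bool → ℝ) → ℝ, ContDiff ℝ 3 a ∧ HasCompactSupport a ∧ ∀ x : (GaugeConfig 3 L (Matrix.specialUnitaryGroup (Fin 2) ℂ)), a (coords x) = gen φ x := by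
    intro φ hφ
    set a₀ : (Edge 3 L × Fin 2 × Fin 2 × Bool → ℝ) → ℝ := fun z => 1 / 2 * ∑ n : Edge 3 L × NoiseIdx (fundamentalLatticeRep 2).N,
      (fderiv ℝ (fun w => fderiv ℝ φ w (s2 n w)) z (s2 n z) + fderiv ℝ ψ z (s2 n z) * fderiv ℝ φ z (s2 n z)) with ha₀
    have ha₀C : ContDiff ℝ 3 a₀ := contDiff_const.mul (contDiff_frameGen (k := 3) hφ hψ4 s2)
    obtain ⟨a, ha, hac, hanear⟩ := exists_contDiff_hasCompactSupport_eqOn (n := 3) ha₀C 1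
    refine ⟨a, ha, hac, fun x => ?_⟩
    have h1 : a (coords x) = a₀ (coords x) := (hanear _ (norm_coords_le_one x)).self_of_nhds
    rw [h1, hD φ (hφ.of_le (by norm_num)) x]
  obtain ⟨b, hb, hbc, hbh⟩ := hrep hh
  obtain ⟨ha2, hb2⟩ : ContDiff ℝ 2 a ∧ ContDiff ℝ 2 b := ⟨ha.of_le (by norm_num), hb.of_le (by norm_num)⟩
  -- §1 Dynkin-class representatives of `κ_s F`, `κ_s(a∘coords)`, `κ_s H`, `κ_s(b∘coords)`
  have hBKf := fun s : ℝ≥0 => transitionKernel_backwardKolmogorov (L := L) β' κ hreal hf3 hfc s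
  have hBKa := fun s : ℝ≥0 => transitionKernel_backwardKolmogorov (L := L) β' κ hreal ha hac s
  have hBKh := fun s : ℝ≥0 => transitionKernel_backwardKolmogorov (L := L) β' κ hreal hh3 hhc s
  have hBKb := fun s : ℝ≥0 => transitionKernel_backwardKolmogorov (L := L) β' κ hreal hb hbc s
  choose gF hgF hgFc hgFrep hgFcomm _ using hBKf
  choose gA hgA hgAc hgArep hgAcomm _ using hBKa
  choose gH hgH hgHc hgHrep hgHcomm _ using hBKh
  choose gB hgB hgBc hgBrep hgBcomm _ using hBKb
  have hgFrep' : ∀ (s : ℝ≥0) (x : (GaugeConfig 3 L (Matrix.specialUnitaryGroup (Fin 2) ℂ))), ∫ y, f (coords y) ∂(κ s x) = gF s (coords x) := fun s x => hgFrep s x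
  have hgArep' : ∀ (s : ℝ≥0) (x : (GaugeConfig 3 L (Matrix.specialUnitaryGroup (Fin 2) ℂ))), ∫ y, a (coords y) ∂(κ s x) = gA s (coords x) := fun s x => hgArep s x
  have hgHrep' : ∀ (s : ℝ≥0) (x : (GaugeConfig 3 L (Matrix.specialUnitaryGroup (Fin 2) ℂ))), ∫ y, h (coords y) ∂(κ s x) = gH s (coords x) := fun s x => hgHrep s x
  have hgBrep' : ∀ (s : ℝ≥0) (x : (GaugeConfig 3 L (Matrix.specialUnitaryGroup (Fin 2) ℂ))), ∫ y, b (coords y) ∂(κ s x) = gB s (coords x) := fun s x => hgBrep s x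
  have hgFcomm' : ∀ (s : ℝ≥0) (x : (GaugeConfig 3 L (Matrix.specialUnitaryGroup (Fin 2) ℂ))), gen (gF s) x = ∫ y, gen f y ∂(κ s x) := fun s x => hgFcomm s x
  have hgAcomm' : ∀ (s : ℝ≥0) (x : (GaugeConfig 3 L (Matrix.specialUnitaryGroup (Fin 2) ℂ))), gen (gA s) x = ∫ y, gen a y ∂(κ s x) := fun s x => hgAcomm s x
  have hgHcomm' : ∀ (s : ℝ≥0) (x : (GaugeConfig 3 L (Matrix.specialUnitaryGroup (Fin 2) ℂ))), gen (gH s) x = ∫ y, gen h y ∂(κ s x) := fun s x => hgHcomm s x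
  have hgBcomm' : ∀ (s : ℝ≥0) (x : (GaugeConfig 3 L (Matrix.specialUnitaryGroup (Fin 2) ℂ))), gen (gB s) x = ∫ y, gen b y ∂(κ s x) := fun s x => hgBcomm s x
  -- §2 the six kernel actions
  have cF : Continuous fun y : (GaugeConfig 3 L (Matrix.specialUnitaryGroup (Fin 2) ℂ)) => f (coords y) := hf3.continuous.comp hco
  have cAf : Continuous fun y : (GaugeConfig 3 L (Matrix.specialUnitaryGroup (Fin 2) ℂ)) => a (coords y) := ha.continuous.comp hco
  have cA2 : Continuous (gen a) := continuous_generator (L := L) β' ha2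
  have cH : Continuous fun y : (GaugeConfig 3 L (Matrix.specialUnitaryGroup (Fin 2) ℂ)) => h (coords y) := hh.continuous.comp hco
  have cBh : Continuous fun y : (GaugeConfig 3 L (Matrix.specialUnitaryGroup (Fin 2) ℂ)) => b (coords y) := hb.continuous.comp hco
  have cB2 : Continuous (gen b) := continuous_generator (L := L) β' hb2
  have hgenf : gen f = fun y => a (coords y) := funext fun y => (haf y).symm
  have hgenh : gen h = fun y => b (coords y) := funext fun y => (hbh y).symm
  obtain ⟨PF, hPF⟩ : ∃ PF : ℝ → (GaugeConfig 3 L (Matrix.specialUnitaryGroup (Fin 2) ℂ)) → ℝ, PF = fun τ x => ∫ y, f (coords y) ∂(κ τ.toNNReal x) := ⟨_, rfl⟩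
  obtain ⟨PA, hPA⟩ : ∃ PA : ℝ → (GaugeConfig 3 L (Matrix.specialUnitaryGroup (Fin 2) ℂ)) → ℝ, PA = fun τ x => ∫ y, a (coords y) ∂(κ τ.toNNReal x) := ⟨_, rfl⟩
  obtain ⟨PA2, hPA2⟩ : ∃ PA2 : ℝ → (GaugeConfig 3 L (Matrix.specialUnitaryGroup (Fin 2) ℂ)) → ℝ, PA2 = fun τ x => ∫ y, gen a y ∂(κ τ.toNNReal x) := ⟨_, rfl⟩
  obtain ⟨PH, hPH⟩ : ∃ PH : ℝ → (GaugeConfig 3 L (Matrix.specialUnitaryGroup (Fin 2) ℂ)) → ℝ, PH = fun τ x => ∫ y, h (coords y) ∂(κ τ.toNNReal x) := ⟨_, rfl⟩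
  obtain ⟨PB, hPB⟩ : ∃ PB : ℝ → (GaugeConfig 3 L (Matrix.specialUnitaryGroup (Fin 2) ℂ)) → ℝ, PB = fun τ x => ∫ y, b (coords y) ∂(κ τ.toNNReal x) := ⟨_, rfl⟩
  obtain ⟨PB2, hPB2⟩ : ∃ PB2 : ℝ → (GaugeConfig 3 L (Matrix.specialUnitaryGroup (Fin 2) ℂ)) → ℝ, PB2 = fun τ x => ∫ y, gen b y ∂(κ τ.toNNReal x) := ⟨_, rfl⟩
  have hcx : ∀ {Φ : (GaugeConfig 3 L (Matrix.specialUnitaryGroup (Fin 2) ℂ)) → ℝ}, Continuous Φ → ∀ τ : ℝ, Continuous fun x => ∫ y, Φ y ∂(κ τ.toNNReal x) :=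
    fun hΦ τ => continuous_integral_transitionKernel L β' κ hreal τ.toNNReal hΦ
  have hct : ∀ {Φ : (GaugeConfig 3 L (Matrix.specialUnitaryGroup (Fin 2) ℂ)) → ℝ}, Continuous Φ → ∀ x : (GaugeConfig 3 L (Matrix.specialUnitaryGroup (Fin 2) ℂ)), Continuous fun τ : ℝ => ∫ y, Φ y ∂(κ τ.toNNReal x) :=
    fun hΦ x => (continuous_transitionKernel_action (L := L) β' κ hreal hΦ).comp (continuous_real_toNNReal.prodMk continuous_const)
  have hbd : ∀ {Φ : (GaugeConfig 3 L (Matrix.specialUnitaryGroup (Fin 2) ℂ)) → ℝ}, Continuous Φ → ∃ M : ℝ, ∀ (τ : ℝ) (x : (GaugeConfig 3 L (Matrix.specialUnitaryGroup (Fin 2) ℂ))), |∫ y, Φ y ∂(κ τ.toNNReal x)| ≤ M := by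
    intro Φ hΦ
    obtain ⟨M, hM⟩ : ∃ M, ∀ y : (GaugeConfig 3 L (Matrix.specialUnitaryGroup (Fin 2) ℂ)), |Φ y| ≤ M := by
      obtain ⟨M, hM⟩ := isCompact_univ.exists_bound_of_continuousOn hΦ.continuousOn
      exact ⟨M, fun y => by simpa [Real.norm_eq_abs] using hM y (Set.mem_univ y)⟩
    refine ⟨M, fun τ x => ?_⟩
    haveI : IsProbabilityMeasure (κ τ.toNNReal x) := IsMarkovKernel.isProbabilityMeasure x
    refine (abs_integral_le_integral_abs).trans ?_
    calc ∫ y, |Φ y| ∂(κ τ.toNNReal x) ≤ ∫ _y, M ∂(κ τ.toNNReal x) :=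
          integral_mono (integrable_of_continuous_of_compactSpace (continuous_abs.comp hΦ) _) (integrable_const _) fun y => hM y
      _ = M := by simp
  have h0 : ∀ {Φ : (GaugeConfig 3 L (Matrix.specialUnitaryGroup (Fin 2) ℂ)) → ℝ}, Continuous Φ → ∀ x : (GaugeConfig 3 L (Matrix.specialUnitaryGroup (Fin 2) ℂ)), ∫ y, Φ y ∂(κ (0 : ℝ).toNNReal x) = Φ x := by
    intro Φ hΦ x
    rw [Real.toNNReal_zero, hκ0, Kernel.id_apply, integral_dirac' _ _ hΦ.measurable.stronglyMeasurable]
  have hDer : ∀ {φ : (Edge 3 L × Fin 2 × Fin 2 × Bool → ℝ) → ℝ}, ContDiff ℝ 3 φ → HasCompactSupport φ → ∀ (x : (GaugeConfig 3 L (Matrix.specialUnitaryGroup (Fin 2) ℂ))) {τ : ℝ}, 0 < τ →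
      HasDerivAt (fun τ : ℝ => ∫ y, φ (coords y) ∂(κ τ.toNNReal x)) (∫ y, gen φ y ∂(κ τ.toNNReal x)) τ := by
    intro φ hφ hφc x τ hτ
    have hDf := fun {σ : ℝ} (hσ : (0 : ℝ) ≤ σ) => transitionKernel_dynkin (L := L) β' κ hreal hφ hφc x hσ
    have hgc : Continuous (gen φ) := continuous_generator (L := L) β' (hφ.of_le (by norm_num))
    have hac : Continuous fun r : ℝ => ∫ y, gen φ y ∂(κ r.toNNReal x) := hct hgc x
    have hder : HasDerivAt (fun σ : ℝ => φ (coords x) + ∫ r in (0 : ℝ)..σ, ∫ y, gen φ y ∂(κ r.toNNReal x))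
        (∫ y, gen φ y ∂(κ τ.toNNReal x)) τ :=
      ((intervalIntegral.integral_hasDerivAt_right (hac.intervalIntegrable _ _)
        (hac.stronglyMeasurableAtFilter _ _) hac.continuousAt)).const_add _
    refine hder.congr_of_eventuallyEq ?_
    filter_upwards [Ioi_mem_nhds hτ] with σ hσ
    exact hDf (le_of_lt hσ)
  obtain ⟨⟨MF, hMF⟩, ⟨MA, hMA⟩, ⟨MA2, hMA2⟩⟩ := And.intro (hbd cF) (And.intro (hbd cAf) (hbd cA2))
  obtain ⟨⟨MH, hMH⟩, ⟨MB, hMB⟩, ⟨MB2, hMB2⟩⟩ := And.intro (hbd cH) (And.intro (hbd cBh) (hbd cB2))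
  have bF : ∀ τ x, |PF τ x| ≤ MF := fun τ x => by rw [hPF]; exact hMF τ x
  have bA : ∀ τ x, |PA τ x| ≤ MA := fun τ x => by rw [hPA]; exact hMA τ x
  have bA2 : ∀ τ x, |PA2 τ x| ≤ MA2 := fun τ x => by rw [hPA2]; exact hMA2 τ x
  have bH : ∀ τ x, |PH τ x| ≤ MH := fun τ x => by rw [hPH]; exact hMH τ x
  have bB : ∀ τ x, |PB τ x| ≤ MB := fun τ x => by rw [hPB]; exact hMB τ x
  have bB2 : ∀ τ x, |PB2 τ x| ≤ MB2 := fun τ x => by rw [hPB2]; exact hMB2 τ x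
  have cxF : ∀ τ, Continuous fun x => PF τ x := fun τ => by rw [hPF]; exact hcx cF τ
  have cxA : ∀ τ, Continuous fun x => PA τ x := fun τ => by rw [hPA]; exact hcx cAf τ
  have cxA2 : ∀ τ, Continuous fun x => PA2 τ x := fun τ => by rw [hPA2]; exact hcx cA2 τ
  have cxH : ∀ τ, Continuous fun x => PH τ x := fun τ => by rw [hPH]; exact hcx cH τ
  have cxB : ∀ τ, Continuous fun x => PB τ x := fun τ => by rw [hPB]; exact hcx cBh τ
  have cxB2 : ∀ τ, Continuous fun x => PB2 τ x := fun τ => by rw [hPB2]; exact hcx cB2 τ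
  have ctF : ∀ x, Continuous fun τ => PF τ x := fun x => by rw [hPF]; exact hct cF x
  have ctA : ∀ x, Continuous fun τ => PA τ x := fun x => by rw [hPA]; exact hct cAf x
  have ctH : ∀ x, Continuous fun τ => PH τ x := fun x => by rw [hPH]; exact hct cH x
  have ctB : ∀ x, Continuous fun τ => PB τ x := fun x => by rw [hPB]; exact hct cBh x
  have dF : ∀ x {τ : ℝ}, 0 < τ → HasDerivAt (fun τ => PF τ x) (PA τ x) τ := fun x τ hτ => by
    have hd := hDer hf3 hfc x hτ
    rw [hgenf] at hd
    rw [hPF, hPA]; exact hd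
  have dA : ∀ x {τ : ℝ}, 0 < τ → HasDerivAt (fun τ => PA τ x) (PA2 τ x) τ := fun x τ hτ => by
    rw [hPA, hPA2]; exact hDer ha hac x hτ
  have dH : ∀ x {τ : ℝ}, 0 < τ → HasDerivAt (fun τ => PH τ x) (PB τ x) τ := fun x τ hτ => by
    have hd := hDer hh3 hhc x hτ
    rw [hgenh] at hd
    rw [hPH, hPB]; exact hd
  have dB : ∀ x {τ : ℝ}, 0 < τ → HasDerivAt (fun τ => PB τ x) (PB2 τ x) τ := fun x τ hτ => by
    rw [hPB, hPB2]; exact hDer hb hbc x hτ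
  -- §3 the flow functional `Λ` and its derivative `Λd`
  set T : ℝ := (t : ℝ) with hT
  have hT0 : 0 ≤ T := t.coe_nonneg
  obtain ⟨Λ, hΛ⟩ : ∃ Λ : ℝ → ℝ, Λ = fun σ => ∫ x, (PB σ x * (PF (T - σ) x * PF (T - σ) x) - 2 * (PH σ x * (PF (T - σ) x * PA (T - σ) x))) ∂μ := ⟨_, rfl⟩
  obtain ⟨Λd, hΛd⟩ : ∃ Λd : ℝ → ℝ, Λd = fun σ => ∫ x, (PB2 σ x * (PF (T - σ) x * PF (T - σ) x) - 4 * (PB σ x * (PF (T - σ) x * PA (T - σ) x)) +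
      2 * (PH σ x * (PA (T - σ) x * PA (T - σ) x + PF (T - σ) x * PA2 (T - σ) x))) ∂μ := ⟨_, rfl⟩
  have hΛc : Continuous Λ := by
    rw [hΛ]
    refine continuous_of_dominated (bound := fun _ => MB * (MF * MF) + 2 * (MH * (MF * MA))) (fun σ => ?_) (fun σ => ?_)
      (integrable_const _) (ae_of_all _ fun x => ?_)
    · exact (((cxB σ).mul ((cxF _).mul (cxF _))).sub (continuous_const.mul ((cxH σ).mul ((cxF _).mul (cxA _))))).aestronglyMeasurable
    · refine ae_of_all _ fun x => ?_
      rw [Real.norm_eq_abs]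
      refine (abs_sub _ _).trans (add_le_add (abs_mul_mul_le (bB σ x) (bF (T - σ) x) (bF (T - σ) x)) ?_)
      rw [abs_mul, show |(2 : ℝ)| = 2 by norm_num]
      exact mul_le_mul_of_nonneg_left (abs_mul_mul_le (bH σ x) (bF (T - σ) x) (bA (T - σ) x)) (by norm_num)
    · have cs : Continuous fun σ : ℝ => T - σ := continuous_const.sub continuous_id
      exact ((ctB x).mul (((ctF x).comp cs).mul ((ctF x).comp cs))).sub
        (continuous_const.mul ((ctH x).mul (((ctF x).comp cs).mul ((ctA x).comp cs))))
  have hΛder : ∀ σ ∈ Ioo 0 T, HasDerivAt Λ (Λd σ) σ := by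
    intro σ hσ
    obtain ⟨hσ0, hσT⟩ := hσ
    rw [hΛ, hΛd]
    have hs : Ioo (σ / 2) ((σ + T) / 2) ∈ 𝓝 σ := Ioo_mem_nhds (by linarith) (by linarith)
    refine (hasDerivAt_integral_of_dominated_loc_of_deriv_le (μ := μ) (x₀ := σ)
      (F := fun σ x => PB σ x * (PF (T - σ) x * PF (T - σ) x) - 2 * (PH σ x * (PF (T - σ) x * PA (T - σ) x)))
      (F' := fun σ x => PB2 σ x * (PF (T - σ) x * PF (T - σ) x) - 4 * (PB σ x * (PF (T - σ) x * PA (T - σ) x)) +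
        2 * (PH σ x * (PA (T - σ) x * PA (T - σ) x + PF (T - σ) x * PA2 (T - σ) x)))
      (bound := fun _ => MB2 * (MF * MF) + 4 * (MB * (MF * MA)) + 2 * (MH * (MA * MA) + MH * (MF * MA2))) hs ?_ ?_ ?_ ?_ (integrable_const _) ?_).2
    · exact Filter.Eventually.of_forall fun σ' =>
        (((cxB σ').mul ((cxF _).mul (cxF _))).sub (continuous_const.mul ((cxH σ').mul ((cxF _).mul (cxA _))))).aestronglyMeasurable
    · exact hInt (((cxB σ).mul ((cxF _).mul (cxF _))).sub (continuous_const.mul ((cxH σ).mul ((cxF _).mul (cxA _)))))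
    · exact ((((cxB2 σ).mul ((cxF _).mul (cxF _))).sub (continuous_const.mul ((cxB σ).mul ((cxF _).mul (cxA _))))).add
        (continuous_const.mul ((cxH σ).mul (((cxA _).mul (cxA _)).add ((cxF _).mul (cxA2 _)))))).aestronglyMeasurable
    · refine ae_of_all _ fun x σ' _ => ?_
      rw [Real.norm_eq_abs, mul_add (PH σ' x)]
      exact abs_flow_deriv_integrand_le (abs_mul_mul_le (bB2 σ' x) (bF (T - σ') x) (bF (T - σ') x))
        (abs_mul_mul_le (bB σ' x) (bF (T - σ') x) (bA (T - σ') x))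
        (abs_mul_mul_le (bH σ' x) (bA (T - σ') x) (bA (T - σ') x)) (abs_mul_mul_le (bH σ' x) (bF (T - σ') x) (bA2 (T - σ') x))
    · refine ae_of_all _ fun x σ' hσ' => ?_
      obtain ⟨hσ'1, hσ'2⟩ := hσ'
      have hσ'0 : 0 < σ' := by linarith
      have hTσ' : 0 < T - σ' := by linarith
      have eB := dB x hσ'0
      have eH := dH x hσ'0
      have eF : HasDerivAt (fun σ => PF (T - σ) x) (-(PA (T - σ') x)) σ' := by
        have hc := HasDerivAt.comp σ' (dF x hTσ') ((hasDerivAt_id σ').const_sub T)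
        exact hc.congr_deriv (by ring)
      have eA : HasDerivAt (fun σ => PA (T - σ) x) (-(PA2 (T - σ') x)) σ' := by
        have hc := HasDerivAt.comp σ' (dA x hTσ') ((hasDerivAt_id σ').const_sub T)
        exact hc.congr_deriv (by ring)
      have hall := (eB.mul (eF.mul eF)).sub ((eH.mul (eF.mul eA)).const_mul 2)
      show HasDerivAt (fun σ => PB σ x * (PF (T - σ) x * PF (T - σ) x) - 2 * (PH σ x * (PF (T - σ) x * PA (T - σ) x)))
        (PB2 σ' x * (PF (T - σ') x * PF (T - σ') x) - 4 * (PB σ' x * (PF (T - σ') x * PA (T - σ') x)) +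
          2 * (PH σ' x * (PA (T - σ') x * PA (T - σ') x + PF (T - σ') x * PA2 (T - σ') x))) σ'
      refine hall.congr_deriv ?_
      show PB2 σ' x * (PF (T - σ') x * PF (T - σ') x) + PB σ' x * (-(PA (T - σ') x) * PF (T - σ') x + PF (T - σ') x * -(PA (T - σ') x)) -
          2 * (PB σ' x * (PF (T - σ') x * PA (T - σ') x) + PH σ' x * (-(PA (T - σ') x) * PA (T - σ') x + PF (T - σ') x * -(PA2 (T - σ') x))) = _
      ring
  -- §4 the key inequality `Λd ≥ (2 − K₀)·Λ` on `(0, T)` and the value `Λ = ∫ κ_sH · Γ^A(κ_(T−s)F)`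
  have hkey : ∀ σ ∈ Ioo 0 T, (2 - K₀) * Λ σ ≤ Λd σ := by
    intro σ hσ
    obtain ⟨hσ0, hσT⟩ := hσ
    set s₁ : ℝ≥0 := σ.toNNReal with hs₁
    set s₂ : ℝ≥0 := (T - σ).toNNReal with hs₂
    have eH : ∀ x, PH σ x = gH s₁ (coords x) := fun x => by rw [hPH]; exact hgHrep' s₁ x
    have eB : ∀ x, PB σ x = gen (gH s₁) x := fun x => by
      rw [hPB, hgHcomm' s₁ x]
      exact integral_congr_ae (ae_of_all _ fun y => hbh y)
    have eBB : ∀ x, gB s₁ (coords x) = gen (gH s₁) x := fun x => by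
      rw [← hgBrep' s₁ x, hgHcomm' s₁ x]
      exact integral_congr_ae (ae_of_all _ fun y => hbh y)
    have eB2 : ∀ x, PB2 σ x = gen (gB s₁) x := fun x => by rw [hPB2, hgBcomm' s₁ x]
    have eF : ∀ x, PF (T - σ) x = gF s₂ (coords x) := fun x => by rw [hPF]; exact hgFrep' s₂ x
    have eA : ∀ x, PA (T - σ) x = gA s₂ (coords x) := fun x => by rw [hPA]; exact hgArep' s₂ x
    have eAA : ∀ x, gA s₂ (coords x) = gen (gF s₂) x := fun x => by
      rw [← hgArep' s₂ x, hgFcomm' s₂ x]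
      exact integral_congr_ae (ae_of_all _ fun y => haf y)
    have eA2 : ∀ x, PA2 (T - σ) x = gen (gA s₂) x := fun x => by rw [hPA2, hgAcomm' s₂ x]
    have hG0 : ∀ x, 0 ≤ gH s₁ (coords x) := fun x => by
      rw [← hgHrep' s₁ x]
      exact integral_nonneg fun y => hh0 y
    have hval : ∫ x, (gen (gH s₁) x * (gF s₂ (coords x) * gF s₂ (coords x)) - 2 * (gH s₁ (coords x) * (gF s₂ (coords x) * gA s₂ (coords x)))) ∂μ =
        ∫ x, gH s₁ (coords x) * (∑ i : Edge 3 L × Fin 2 × Fin 2 × Bool, ∑ j : Edge 3 L × Fin 2 × Fin 2 × Bool, fderiv ℝ (gF s₂) (coords x) (Pi.single i 1) * fderiv ℝ (gF s₂) (coords x) (Pi.single j 1) * A x i j) ∂μ :=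
      flow_value_eq_integral_mul_carre L β' (hgH s₁) (hgHc s₁) (hgF s₂) (hgFc s₂) (hgA s₂) eAA
    have hder : (2 - K₀) * ∫ x, gH s₁ (coords x) * (∑ i : Edge 3 L × Fin 2 × Fin 2 × Bool, ∑ j : Edge 3 L × Fin 2 × Fin 2 × Bool, fderiv ℝ (gF s₂) (coords x) (Pi.single i 1) * fderiv ℝ (gF s₂) (coords x) (Pi.single j 1) * A x i j) ∂μ ≤
        ∫ x, (gen (gB s₁) x * (gF s₂ (coords x) * gF s₂ (coords x)) - 4 * (gen (gH s₁) x * (gF s₂ (coords x) * gA s₂ (coords x))) +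
          2 * (gH s₁ (coords x) * (gA s₂ (coords x) * gA s₂ (coords x) + gF s₂ (coords x) * gen (gA s₂) x))) ∂μ :=
      flow_deriv_ge_of_hessBound L β' K₀ hHess (hgH s₁) (hgHc s₁) (hgB s₁) (hgBc s₁) (hgF s₂) (hgFc s₂) (hgA s₂) (hgAc s₂) eBB eAA hG0
    have hΛσ : Λ σ = ∫ x, gH s₁ (coords x) * (∑ i : Edge 3 L × Fin 2 × Fin 2 × Bool, ∑ j : Edge 3 L × Fin 2 × Fin 2 × Bool, fderiv ℝ (gF s₂) (coords x) (Pi.single i 1) * fderiv ℝ (gF s₂) (coords x) (Pi.single j 1) * A x i j) ∂μ := by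
      rw [hΛ, ← hval]
      exact integral_congr_ae (ae_of_all _ fun x => by simp only [eB x, eH x, eF x, eA x])
    have hΛdσ : Λd σ = ∫ x, (gen (gB s₁) x * (gF s₂ (coords x) * gF s₂ (coords x)) - 4 * (gen (gH s₁) x * (gF s₂ (coords x) * gA s₂ (coords x))) +
        2 * (gH s₁ (coords x) * (gA s₂ (coords x) * gA s₂ (coords x) + gF s₂ (coords x) * gen (gA s₂) x))) ∂μ := by
      rw [hΛd]
      exact integral_congr_ae (ae_of_all _ fun x => by simp only [eB2 x, eB x, eH x, eF x, eA x, eA2 x])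
    rw [hΛσ, hΛdσ]
    exact hder
  -- §5 Grönwall on `[0, T]`
  have hgron : Real.exp ((2 - K₀) * T) * Λ 0 ≤ Λ T :=
    exp_mul_le_of_hasDerivAt_ge hT0 hΛc.continuousOn hΛder hkey
  -- §6 the endpoints
  have cG : Continuous fun x : (GaugeConfig 3 L (Matrix.specialUnitaryGroup (Fin 2) ℂ)) => g (coords x) := hg.continuous.comp hco
  have hTt : T.toNNReal = t := by rw [hT, Real.toNNReal_coe]
  have hΛ0 : Λ 0 = ∫ x, h (coords x) * (∑ i : Edge 3 L × Fin 2 × Fin 2 × Bool, ∑ j : Edge 3 L × Fin 2 × Fin 2 × Bool, fderiv ℝ g (coords x) (Pi.single i 1) * fderiv ℝ g (coords x) (Pi.single j 1) * A x i j) ∂μ := by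
    have eF : ∀ x, PF T x = g (coords x) := fun x => by rw [hPF]; show ∫ y, f (coords y) ∂(κ T.toNNReal x) = _; rw [hTt]; exact hgrep x
    have egg : ∀ x, gen (gF t) x = gen g x := fun x =>
      generator_eq_of_eqOn_group (L := L) β' (hgF t) (hgFc t) hg hgc (fun V => by rw [← hgFrep' t V, ← hgrep V]) x
    have eAA : ∀ x, gA t (coords x) = gen g x := fun x => by
      rw [← egg x, ← hgArep' t x, hgFcomm' t x]
      exact integral_congr_ae (ae_of_all _ fun y => haf y)
    have eA : ∀ x, PA T x = gA t (coords x) := fun x => by rw [hPA]; show ∫ y, a (coords y) ∂(κ T.toNNReal x) = _; rw [hTt]; exact hgArep' t x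
    have eH : ∀ x, PH 0 x = h (coords x) := fun x => by rw [hPH]; exact h0 cH x
    have eB : ∀ x, PB 0 x = gen h x := fun x => by rw [hPB]; show ∫ y, b (coords y) ∂(κ (0 : ℝ).toNNReal x) = _; rw [h0 cBh x]; exact hbh x
    have hval : ∫ x, (gen h x * (g (coords x) * g (coords x)) - 2 * (h (coords x) * (g (coords x) * gA t (coords x)))) ∂μ = ∫ x, h (coords x) * (∑ i : Edge 3 L × Fin 2 × Fin 2 × Bool, ∑ j : Edge 3 L × Fin 2 × Fin 2 × Bool, fderiv ℝ g (coords x) (Pi.single i 1) * fderiv ℝ g (coords x) (Pi.single j 1) * A x i j) ∂μ :=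
      flow_value_eq_integral_mul_carre L β' hh3 hhc hg hgc (hgA t) eAA
    rw [hΛ, ← hval]
    exact integral_congr_ae (ae_of_all _ fun x => by simp only [sub_zero, eB x, eH x, eF x, eA x])
  have hΛT : Λ T = ∫ x, h (coords x) * (∫ y, (∑ i : Edge 3 L × Fin 2 × Fin 2 × Bool, ∑ j : Edge 3 L × Fin 2 × Fin 2 × Bool, fderiv ℝ f (coords y) (Pi.single i 1) * fderiv ℝ f (coords y) (Pi.single j 1) * A y i j) ∂(κ t x)) ∂μ := by
    have eF : ∀ x, PF (T - T) x = f (coords x) := fun x => by rw [hPF, sub_self]; exact h0 cF x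
    have eA : ∀ x, PA (T - T) x = a (coords x) := fun x => by rw [hPA, sub_self]; exact h0 cAf x
    have eH : ∀ x, PH T x = gH t (coords x) := fun x => by rw [hPH]; show ∫ y, h (coords y) ∂(κ T.toNNReal x) = _; rw [hTt]; exact hgHrep' t x
    have eB : ∀ x, PB T x = gen (gH t) x := fun x => by
      rw [hPB]; show ∫ y, b (coords y) ∂(κ T.toNNReal x) = _; rw [hTt, hgHcomm' t x]
      exact integral_congr_ae (ae_of_all _ fun y => hbh y)
    have hval : ∫ x, (gen (gH t) x * (f (coords x) * f (coords x)) - 2 * (gH t (coords x) * (f (coords x) * a (coords x)))) ∂μ =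
        ∫ x, gH t (coords x) * (∑ i : Edge 3 L × Fin 2 × Fin 2 × Bool, ∑ j : Edge 3 L × Fin 2 × Fin 2 × Bool, fderiv ℝ f (coords x) (Pi.single i 1) * fderiv ℝ f (coords x) (Pi.single j 1) * A x i j) ∂μ :=
      flow_value_eq_integral_mul_carre L β' (hgH t) (hgHc t) hf3 hfc ha haf
    have cΓ : Continuous fun x : (GaugeConfig 3 L (Matrix.specialUnitaryGroup (Fin 2) ℂ)) => (∑ i : Edge 3 L × Fin 2 × Fin 2 × Bool, ∑ j : Edge 3 L × Fin 2 × Fin 2 × Bool, fderiv ℝ f (coords x) (Pi.single i 1) * fderiv ℝ f (coords x) (Pi.single j 1) * A x i j) := by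
      have hleib : ∀ x : (GaugeConfig 3 L (Matrix.specialUnitaryGroup (Fin 2) ℂ)), gen (fun z => f z * f z) x = f (coords x) * gen f x + f (coords x) * gen f x + (∑ i : Edge 3 L × Fin 2 × Fin 2 × Bool, ∑ j : Edge 3 L × Fin 2 × Fin 2 × Bool, fderiv ℝ f (coords x) (Pi.single i 1) * fderiv ℝ f (coords x) (Pi.single j 1) * A x i j) :=
        fun x => generator_mul_coords L β' hf2 hf2 x
      have e : (fun x : (GaugeConfig 3 L (Matrix.specialUnitaryGroup (Fin 2) ℂ)) => (∑ i : Edge 3 L × Fin 2 × Fin 2 × Bool, ∑ j : Edge 3 L × Fin 2 × Fin 2 × Bool, fderiv ℝ f (coords x) (Pi.single i 1) * fderiv ℝ f (coords x) (Pi.single j 1) * A x i j)) = fun x => gen (fun z => f z * f z) x - (f (coords x) * gen f x + f (coords x) * gen f x) := by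
        funext x; rw [hleib x]; ring
      rw [e]
      exact (continuous_generator (L := L) β' ((hf3.mul hf3).of_le (by norm_num))).sub
        ((cF.mul (continuous_generator (L := L) β' hf2)).add (cF.mul (continuous_generator (L := L) β' hf2)))
    have hsym := integral_mul_transition_symm_su2 L β' κ hreal t cH cΓ
    rw [hΛ]
    calc (fun σ => ∫ x, (PB σ x * (PF (T - σ) x * PF (T - σ) x) - 2 * (PH σ x * (PF (T - σ) x * PA (T - σ) x))) ∂μ) T
        = ∫ x, (gen (gH t) x * (f (coords x) * f (coords x)) - 2 * (gH t (coords x) * (f (coords x) * a (coords x)))) ∂μ :=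
          integral_congr_ae (ae_of_all _ fun x => by simp only [eB x, eH x, eF x, eA x])
      _ = ∫ x, gH t (coords x) * (∑ i : Edge 3 L × Fin 2 × Fin 2 × Bool, ∑ j : Edge 3 L × Fin 2 × Fin 2 × Bool, fderiv ℝ f (coords x) (Pi.single i 1) * fderiv ℝ f (coords x) (Pi.single j 1) * A x i j) ∂μ := hval
      _ = ∫ x, (∫ y, h (coords y) ∂(κ t x)) * (∑ i : Edge 3 L × Fin 2 × Fin 2 × Bool, ∑ j : Edge 3 L × Fin 2 × Fin 2 × Bool, fderiv ℝ f (coords x) (Pi.single i 1) * fderiv ℝ f (coords x) (Pi.single j 1) * A x i j) ∂μ :=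
          integral_congr_ae (ae_of_all _ fun x => by simp only [hgHrep' t x])
      _ = ∫ x, (∑ i : Edge 3 L × Fin 2 × Fin 2 × Bool, ∑ j : Edge 3 L × Fin 2 × Fin 2 × Bool, fderiv ℝ f (coords x) (Pi.single i 1) * fderiv ℝ f (coords x) (Pi.single j 1) * A x i j) * (∫ y, h (coords y) ∂(κ t x)) ∂μ :=
          integral_congr_ae (ae_of_all _ fun x => mul_comm _ _)
      _ = ∫ x, h (coords x) * (∫ y, (∑ i : Edge 3 L × Fin 2 × Fin 2 × Bool, ∑ j : Edge 3 L × Fin 2 × Fin 2 × Bool, fderiv ℝ f (coords y) (Pi.single i 1) * fderiv ℝ f (coords y) (Pi.single j 1) * A y i j) ∂(κ t x)) ∂μ := hsym.symm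
  rw [← hΛ0, ← hΛT]
  exact hgron

end Summit.QuantumFields.YangMills.Theorems.ColdStartUniversality
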